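import Literature.Barriers.CriticalPhenomena.RigorousRGSmallParameterTauTphiNorm
import Literature.Barriers.CriticalPhenomena.RigorousRGSmallParameterTphiLaplacian
import HarnessLib

/-!
# `RigorousRGSmallParameter` (Slade, Theorem 1.4.1): stability of `e^{-V(X)}` in the `T_φ` norm —
# `‖e^{-gτ_x²}‖_{T_φ} ≤ e^{g(K(q)(n/2)²𝔥⁴ - q(n/2)𝔥²τ_x(φ))}` and `‖e^{-V(X)}‖_{T_φ}` ([BS-rg-IE] §5)

Companion ("proof architecture") file of
`Literature/Barriers/CriticalPhenomena/RigorousRGSmallParameter.lean` (estimates layer behind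
Theorem 6.3.1 / `Slade2017_prop822`). [BS-rg-IE] §5, proof of Proposition (prop:Iupperzz):
"We write `V = gτ² + Q`. By [BS-rg-norm] … `‖e^{-gτ_x²}‖_{T_φ} ≤ e^{O(|g|𝔥⁴)}` (5.4). By the
product property, `‖e^{-gτ²(b)}‖_{T_φ} ≤ ∏_{x∈b}‖e^{-gτ_x²}‖_{T_φ}` (5.5) … by the power series
expansion of the exponential and the product property, `‖e^{-Q(b)}‖_{T_φ} ≤ e^{‖Q(b)‖_{T_φ}}` (5.7)
… (ii) … `‖e^{-gτ_x²}‖_{T_φ} ≤ e^{O(1+q'²)|g|𝔥⁴}e^{-q'|g|𝔥⁴|φ_x/𝔥|²}` (5.9)". This file PROVES these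
steps for Slade's real `n`-component `V = gτ² + ντ + u` with `g ≥ 0`, with explicit constants, from
Proposition 3.4.6 (`…TphiExponential.TphiNorm_exp_neg_le_lattice`), the product property and
`‖τ_x‖_{T_φ} ≤ (√τ_x(φ)+√(n/2)𝔥)²` (`…TauTphiNorm`):

* `quarticK`, **`quartic_ineq`** (`(s+a)⁴ - 2s⁴ + qa²s² ≤ (½(16+q)²+3)a⁴`, all reals);
* `TphiNorm_exp_neg_tau_sq_le_raw`, **`TphiNorm_exp_neg_tau_sq_le`** ((5.4)/(5.9):
  `‖e^{-gτ_x²}‖_{T_φ(𝔥)} ≤ exp(g[K(q)(n/2)²𝔥⁴ - q(n/2)𝔥²τ_x(φ)])`);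
* `TphiNorm_finset_prod_le` (product property over finite products),
  **`TphiNorm_exp_neg_tau_sq_sum_le`** ((5.5)/(5.10)), **`TphiNorm_exp_neg_quadratic_le`** ((5.6)–(5.7):
  `‖e^{-Q(X)}‖_{T_φ} ≤ exp(4|ν|Σ_xτ_x(φ) + 2|X|(|ν|n𝔥²+|u|))`);
* **`TphiNorm_exp_neg_localPolySum_le`**: `‖e^{-V(X)}‖_{T_φ(𝔥)} ≤
  exp(|X|[gK(q)(n/2)²𝔥⁴ + 2|ν|n𝔥² + 2|u|] + (4|ν| - qg(n/2)𝔥²)Σ_{x∈X}τ_x(φ))` for every `q` — with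
  `qg(n/2)𝔥² ≥ 4|ν|` a field-independent stability bound (Proposition (prop:Iupperzz)(i): "`‖𝓘(b)‖_{T_φ} ≤ e^{O(ε_V(b))(1+‖φ‖²_Φ)}`").

Not treated here: the complex coupling `g` with `|Im g| ≤ ½Re g`, the `Φ̃`/`L²` regulator form of
(ii) (Proposition (prop:equivalent-norms)), and the `(1+W)` factors of Proposition 2.1.1.

Sources: D. C. Brydges, G. Slade, *A renormalisation group method. IV. Stability analysis*, J.
Stat. Phys. 159 (2015) 530–588, arXiv:1403.7255, §5 (Proposition (prop:Iupperzz) and (5.4)–(5.10),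
TeX-source numbering); Brydges–Slade I, arXiv:1403.7244, Propositions 3.4.5–3.4.6, 3.5.1; G. Slade,
arXiv:1611.06169, §6.4.3.

## References

* [BrydgesSlade2015] D. C. Brydges, G. Slade, *A renormalisation group method. IV*, J. Stat.
  Phys. **159** (2015) 530–588, arXiv:1403.7255.
* [BrydgesSlade2015RGI] D. C. Brydges, G. Slade, *A renormalisation group method. I*, J. Stat.
  Phys. **159** (2015) 421–460, arXiv:1403.7244.
* [Slade2017] G. Slade, *Critical exponents for long-range O(n) models below the upper critical
  dimension*, Commun. Math. Phys. **358** (2018) 343–436, arXiv:1611.06169.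
-/

noncomputable section

namespace Literature.Barriers.CriticalPhenomena

namespace LongRangePhi4

namespace LocalPoly

open Finset Tphi RGNorm Literature.Probability.LatticeModels
open scoped ContDiff

variable {d M n : ℕ} [NeZero M]

/-! ### The quartic inequality `(s+a)⁴ - 2s⁴ ≤ K(q)a⁴ - q a²s²` -/

/-- The constant `K(q) = ½(16+q)² + 3` of the quartic inequality. [folklore] -/
def quarticK (q : ℝ) : ℝ := 2⁻¹ * (16 + q) ^ 2 + 3

omit [NeZero M] in
/-- **`(s+a)⁴ - 2s⁴ + q a²s² ≤ K(q) a⁴`** (for all real `s, a, q`) — the elementary estimate behind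
"`‖e^{-gτ_x²}‖_{T_φ} ≤ e^{O(1+q'²)|g|𝔥⁴} e^{-q'|g|𝔥⁴|φ_x/𝔥|²}`" (BS-rg-norm Proposition 3.5.x /
[BS-rg-IE] (5.9)): `4as³ ≤ ½s⁴ + 8a²s²`, `4a³s ≤ 2a²s² + 2a⁴`, and `-½s⁴ + bs² ≤ ½b²`. [cite: BrydgesSlade2015, §5 (display (5.9))] -/
theorem quartic_ineq (s a q : ℝ) :
    (s + a) ^ 4 - 2 * s ^ 4 + q * a ^ 2 * s ^ 2 ≤ quarticK q * a ^ 4 := by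
  unfold quarticK
  nlinarith [sq_nonneg (s ^ 2 - 4 * a * s), sq_nonneg (s - a), sq_nonneg (s ^ 2 - (16 + q) * a ^ 2),
    sq_nonneg s, sq_nonneg a, sq_nonneg (a * s)]

/-! ### `‖e^{-gτ_x²}‖_{T_φ}` -/

/-- **`‖e^{-gτ_x²}‖_{T_φ(𝔥)} ≤ exp(g[(√τ_x(φ) + √(n/2)𝔥)⁴ - 2τ_x(φ)²])`** for `g ≥ 0`: Proposition 3.4.6
(`‖e^{-F}‖_{T_φ} ≤ e^{-2F(φ)+‖F‖_{T_φ}}`) with `F = gτ_x²`, the product property and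
`‖τ_x‖_{T_φ} ≤ (√τ_x(φ)+√(n/2)𝔥)²`. [cite: BrydgesSlade2015RGI, Proposition 3.4.6] [cite: BrydgesSlade2015, §5 ((5.4): ‖e^{-gτ_x²}‖_{T_φ} ≤ e^{O(|g|𝔥⁴)})] -/
theorem TphiNorm_exp_neg_tau_sq_le_raw {𝔥 R : ℝ} (h𝔥 : 0 < 𝔥) (hR : 0 < R) (pΦ pN : ℕ) {g : ℝ} (hg : 0 ≤ g)
    (x : TorusSite d M) (φ : TorusSite d M → Fin n → ℝ) :
    TphiNorm pN (latticeFamily (unitStep d M) 𝔥 R pΦ) (basisDir d M n) (fun ψ => Real.exp (-(g * (tau x ψ * tau x ψ)))) φ ≤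
      Real.exp (g * ((Real.sqrt (tau x φ) + Real.sqrt (2⁻¹ * n) * 𝔥) ^ 4 - 2 * tau x φ ^ 2)) := by
  have hτ := contDiff_tau (d := d) (M := M) (n := n) x
  have hτ2 : ContDiff ℝ ∞ (fun ψ => tau (d := d) (M := M) (n := n) x ψ * tau x ψ) := hτ.mul hτ
  have hF : ContDiff ℝ ∞ (fun ψ => g * (tau (d := d) (M := M) (n := n) x ψ * tau x ψ)) := contDiff_const.mul hτ2
  have h1 := TphiNorm_exp_neg_le_lattice (unitStep d M) h𝔥 hR pΦ pN (basisDir d M n) hF φ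
  refine h1.trans (Real.exp_le_exp.2 ?_)
  have h2 : TphiNorm pN (latticeFamily (unitStep d M) 𝔥 R pΦ) (basisDir d M n) (fun ψ => g * (tau x ψ * tau x ψ)) φ ≤
      g * (Real.sqrt (tau x φ) + Real.sqrt (2⁻¹ * n) * 𝔥) ^ 4 := by
    refine (TphiNorm_const_mul_le h𝔥 hR pΦ pN g hτ2 φ).trans ?_
    rw [abs_of_nonneg hg]
    refine mul_le_mul_of_nonneg_left ?_ hg
    refine (TphiNorm_mul_le_lattice (unitStep d M) h𝔥 hR pΦ pN (basisDir d M n) hτ hτ φ).trans ?_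
    have h3 := TphiNorm_tau_le_sq h𝔥 hR pΦ pN x φ
    have h0 := TphiNorm_nonneg pN (latticeFamily (unitStep d M) 𝔥 R pΦ) (basisDir d M n) (tau x) φ
    calc _ ≤ (Real.sqrt (tau x φ) + Real.sqrt (2⁻¹ * n) * 𝔥) ^ 2 * (Real.sqrt (tau x φ) + Real.sqrt (2⁻¹ * n) * 𝔥) ^ 2 :=
          mul_le_mul h3 h3 h0 (by positivity)
      _ = _ := by ring
  have e : -2 * (g * (tau x φ * tau x φ)) = g * (-(2 * tau x φ ^ 2)) := by ring
  rw [e]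
  linarith

/-- **`‖e^{-gτ_x²}‖_{T_φ(𝔥)} ≤ exp(g[K(q)(n/2)²𝔥⁴ - q(n/2)𝔥² τ_x(φ)])`** for `g, q ≥ 0` — the real
`n`-component form of "`‖e^{-gτ_x²}‖_{T_φ} ≤ e^{O(1+q'²)|g|𝔥⁴} e^{-q'|g|𝔥⁴|φ_x/𝔥|²}`" ((5.9) of
[BS-rg-IE]; (5.4) is the case `q = 0`). [cite: BrydgesSlade2015, §5 (displays (5.4), (5.9))] -/
theorem TphiNorm_exp_neg_tau_sq_le {𝔥 R : ℝ} (h𝔥 : 0 < 𝔥) (hR : 0 < R) (pΦ pN : ℕ) {g : ℝ} (q : ℝ) (hg : 0 ≤ g)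
    (x : TorusSite d M) (φ : TorusSite d M → Fin n → ℝ) :
    TphiNorm pN (latticeFamily (unitStep d M) 𝔥 R pΦ) (basisDir d M n) (fun ψ => Real.exp (-(g * (tau x ψ * tau x ψ)))) φ ≤
      Real.exp (g * (quarticK q * (2⁻¹ * n) ^ 2 * 𝔥 ^ 4 - q * (2⁻¹ * n) * 𝔥 ^ 2 * tau x φ)) := by
  refine (TphiNorm_exp_neg_tau_sq_le_raw h𝔥 hR pΦ pN hg x φ).trans (Real.exp_le_exp.2 ?_)
  refine mul_le_mul_of_nonneg_left ?_ hg
  have hτ0 := tau_nonneg x φ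
  have hn : (0 : ℝ) ≤ 2⁻¹ * n := by positivity
  set s := Real.sqrt (tau x φ) with hs
  set a := Real.sqrt (2⁻¹ * n) * 𝔥 with ha
  have hs2 : s ^ 2 = tau x φ := Real.sq_sqrt hτ0
  have ha2 : a ^ 2 = 2⁻¹ * n * 𝔥 ^ 2 := by rw [ha, mul_pow, Real.sq_sqrt hn]
  have hq' := quartic_ineq s a q
  have e1 : tau x φ ^ 2 = s ^ 4 := by rw [← hs2]; ring
  have e2 : quarticK q * (2⁻¹ * n) ^ 2 * 𝔥 ^ 4 = quarticK q * a ^ 4 := by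
    rw [show a ^ 4 = (a ^ 2) ^ 2 by ring, ha2]; ring
  have e3 : q * (2⁻¹ * n) * 𝔥 ^ 2 * tau x φ = q * a ^ 2 * s ^ 2 := by rw [ha2, hs2]; ring
  rw [e1, e2, e3]
  linarith

/-! ### The product property over finite products; `e^{-gτ²(X)}`, `e^{-Q(X)}`, `e^{-V(X)}` -/

/-- Finite products of smooth functions are smooth (pointwise form). [folklore] -/
theorem contDiff_finset_prod' {β : Type*} (s : Finset β) {F : β → (TorusSite d M → Fin n → ℝ) → ℝ}
    (hF : ∀ i ∈ s, ContDiff ℝ ∞ (F i)) : ContDiff ℝ ∞ (fun ψ => ∏ i ∈ s, F i ψ) :=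
  contDiff_prod hF

/-- **The product property over finite products**: `‖∏_{i∈s} F_i‖_{T_φ} ≤ ∏_{i∈s} ‖F_i‖_{T_φ}` (lattice
norms). [cite: BrydgesSlade2015RGI, Proposition 3.4.5] -/
theorem TphiNorm_finset_prod_le {𝔥 R : ℝ} (h𝔥 : 0 < 𝔥) (hR : 0 < R) (pΦ pN : ℕ) {β : Type*} (s : Finset β)
    {F : β → (TorusSite d M → Fin n → ℝ) → ℝ} (hF : ∀ i ∈ s, ContDiff ℝ ∞ (F i)) (φ : TorusSite d M → Fin n → ℝ) :
    TphiNorm pN (latticeFamily (unitStep d M) 𝔥 R pΦ) (basisDir d M n) (fun ψ => ∏ i ∈ s, F i ψ) φ ≤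
      ∏ i ∈ s, TphiNorm pN (latticeFamily (unitStep d M) 𝔥 R pΦ) (basisDir d M n) (F i) φ := by
  classical
  induction s using Finset.induction_on with
  | empty =>
    simp only [Finset.prod_empty]
    exact (TphiNorm_const_le h𝔥 hR pΦ pN 1 φ).trans (by simp)
  | @insert a s ha ih =>
    simp only [Finset.prod_insert ha]
    have hFs : ∀ i ∈ s, ContDiff ℝ ∞ (F i) := fun i hi => hF i (Finset.mem_insert_of_mem hi)
    have h1 := TphiNorm_mul_le_lattice (unitStep d M) h𝔥 hR pΦ pN (basisDir d M n) (hF a (Finset.mem_insert_self a s))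
      (contDiff_finset_prod' s hFs) φ
    refine h1.trans (mul_le_mul_of_nonneg_left (ih hFs) (TphiNorm_nonneg _ _ _ _ _))

/-- **`‖e^{-gτ²(X)}‖_{T_φ(𝔥)} ≤ exp(g[|X|K(q)(n/2)²𝔥⁴ - q(n/2)𝔥² Σ_{x∈X} τ_x(φ)])`** for `g ≥ 0` ("By the
product property, `‖e^{-gτ²(b)}‖_{T_φ} ≤ ∏_{x∈b}‖e^{-gτ_x²}‖_{T_φ} ≤ e^{O(L^{-d}ε̄)}`", (5.5); with decay
(5.10)). [cite: BrydgesSlade2015, §5 (displays (5.5), (5.10))] -/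
theorem TphiNorm_exp_neg_tau_sq_sum_le {𝔥 R : ℝ} (h𝔥 : 0 < 𝔥) (hR : 0 < R) (pΦ pN : ℕ) {g : ℝ} (q : ℝ) (hg : 0 ≤ g)
    (X : Finset (TorusSite d M)) (φ : TorusSite d M → Fin n → ℝ) :
    TphiNorm pN (latticeFamily (unitStep d M) 𝔥 R pΦ) (basisDir d M n)
      (fun ψ => Real.exp (-(g * ∑ x ∈ X, tau x ψ * tau x ψ))) φ ≤
      Real.exp (g * (X.card * (quarticK q * (2⁻¹ * n) ^ 2 * 𝔥 ^ 4) - q * (2⁻¹ * n) * 𝔥 ^ 2 * ∑ x ∈ X, tau x φ)) := by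
  have hτ : ∀ x : TorusSite d M, ContDiff ℝ ∞ (fun ψ => Real.exp (-(g * (tau (d := d) (M := M) (n := n) x ψ * tau x ψ)))) :=
    fun x => Real.contDiff_exp.comp (contDiff_const.mul ((contDiff_tau x).mul (contDiff_tau x))).neg
  have e : (fun ψ : TorusSite d M → Fin n → ℝ => Real.exp (-(g * ∑ x ∈ X, tau x ψ * tau x ψ))) =
      fun ψ => ∏ x ∈ X, Real.exp (-(g * (tau x ψ * tau x ψ))) := by
    funext ψ
    rw [← Real.exp_sum, Finset.mul_sum, ← Finset.sum_neg_distrib]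
  rw [e]
  refine (TphiNorm_finset_prod_le h𝔥 hR pΦ pN X (fun x _ => hτ x) φ).trans ?_
  refine (Finset.prod_le_prod (fun x _ => TphiNorm_nonneg _ _ _ _ _)
    (fun x _ => TphiNorm_exp_neg_tau_sq_le h𝔥 hR pΦ pN q hg x φ)).trans (le_of_eq ?_)
  rw [← Real.exp_sum]
  congr 1
  rw [← Finset.mul_sum, Finset.sum_sub_distrib, Finset.sum_const, nsmul_eq_mul, ← Finset.mul_sum]

/-- **`‖e^{-Q(X)}‖_{T_φ(𝔥)} ≤ exp(2‖Q(X)‖_{T_φ}) ≤ exp(4|ν|Σ_xτ_x(φ) + 2|X|(|ν|n𝔥² + |u|))`** for the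
quadratic part `Q = ντ + u` ("by the power series expansion of the exponential and the product
property, `‖e^{-Q(b)}‖_{T_φ} ≤ e^{‖Q(b)‖_{T_φ}}`", (5.7), here from Proposition 3.4.6 and the local
bound `‖τ_x‖_{T_φ} ≤ (√τ_x+√(n/2)𝔥)² ≤ 2τ_x + n𝔥²`). [cite: BrydgesSlade2015, §5 (displays (5.6)–(5.7))] -/
theorem TphiNorm_exp_neg_quadratic_le {𝔥 R : ℝ} (h𝔥 : 0 < 𝔥) (hR : 0 < R) (pΦ pN : ℕ) (ν u : ℝ)
    (X : Finset (TorusSite d M)) (φ : TorusSite d M → Fin n → ℝ) :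
    TphiNorm pN (latticeFamily (unitStep d M) 𝔥 R pΦ) (basisDir d M n)
      (fun ψ => Real.exp (-(∑ x ∈ X, (ν * tau x ψ + u)))) φ ≤
      Real.exp (4 * |ν| * ∑ x ∈ X, tau x φ + 2 * X.card * (|ν| * n * 𝔥 ^ 2 + |u|)) := by
  have hQx : ∀ x : TorusSite d M, ContDiff ℝ ∞ (fun ψ => ν * tau (d := d) (M := M) (n := n) x ψ + u) :=
    fun x => (contDiff_const.mul (contDiff_tau x)).add contDiff_const
  have hQ : ContDiff ℝ ∞ (fun ψ : TorusSite d M → Fin n → ℝ => ∑ x ∈ X, (ν * tau x ψ + u)) :=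
    ContDiff.sum fun x _ => hQx x
  refine (TphiNorm_exp_neg_le_lattice' (unitStep d M) h𝔥 hR pΦ pN (basisDir d M n) hQ φ).trans (Real.exp_le_exp.2 ?_)
  -- `‖Q(X)‖_{T_φ} ≤ Σ_x (|ν|‖τ_x‖ + |u|)`
  have hsum : TphiNorm pN (latticeFamily (unitStep d M) 𝔥 R pΦ) (basisDir d M n) (fun ψ => ∑ x ∈ X, (ν * tau x ψ + u)) φ ≤
      ∑ x ∈ X, (2 * |ν| * tau x φ + (|ν| * n * 𝔥 ^ 2 + |u|)) := by
    have e : coeffFamily (basisDir d M n) (fun ψ : TorusSite d M → Fin n → ℝ => ∑ x ∈ X, (ν * tau x ψ + u)) φ =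
        fun z => ∑ x ∈ X, coeffFamily (basisDir d M n) (fun ψ => ν * tau x ψ + u) φ z := by
      funext z
      simp only [coeffFamily]
      rw [coeff_finset_sum _ X (fun x _ => hQx x) z]
    unfold TphiNorm
    rw [e]
    refine (Tnorm_sum_le (latticeFamily_evalBound (unitStep d M) h𝔥 hR pΦ pN (ι := Fin n)) X _).trans
      (Finset.sum_le_sum fun x _ => ?_)
    have h1 := TphiNorm_add_le_lattice (unitStep d M) h𝔥 hR pΦ pN (basisDir d M n)
      (F := fun ψ => ν * tau (d := d) (M := M) (n := n) x ψ) (G := fun _ => u) (contDiff_const.mul (contDiff_tau x)) contDiff_const φ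
    have hu := TphiNorm_const_le h𝔥 hR pΦ pN u φ
    have h2 := TphiNorm_tau_le_sq h𝔥 hR pΦ pN x φ
    have hτ0 := tau_nonneg x φ
    have hn : (0 : ℝ) ≤ 2⁻¹ * n := by positivity
    have h3 : (Real.sqrt (tau x φ) + Real.sqrt (2⁻¹ * n) * 𝔥) ^ 2 ≤ 2 * tau x φ + n * 𝔥 ^ 2 := by
      have := sq_nonneg (Real.sqrt (tau x φ) - Real.sqrt (2⁻¹ * n) * 𝔥)
      nlinarith [Real.sq_sqrt hτ0, Real.sq_sqrt hn, mul_pow (Real.sqrt (2⁻¹ * n)) 𝔥 2]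
    have hντ : TphiNorm pN (latticeFamily (unitStep d M) 𝔥 R pΦ) (basisDir d M n) (fun ψ => ν * tau x ψ) φ ≤
        2 * |ν| * tau x φ + |ν| * n * 𝔥 ^ 2 := by
      refine (TphiNorm_const_mul_le h𝔥 hR pΦ pN ν (contDiff_tau x) φ).trans ?_
      calc |ν| * TphiNorm pN (latticeFamily (unitStep d M) 𝔥 R pΦ) (basisDir d M n) (tau x) φ
          ≤ |ν| * (2 * tau x φ + n * 𝔥 ^ 2) := mul_le_mul_of_nonneg_left (h2.trans h3) (abs_nonneg ν)
        _ = 2 * |ν| * tau x φ + |ν| * n * 𝔥 ^ 2 := by ring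
    change TphiNorm pN (latticeFamily (unitStep d M) 𝔥 R pΦ) (basisDir d M n) (fun ψ => ν * tau x ψ + u) φ ≤ _
    linarith
  calc 2 * TphiNorm pN (latticeFamily (unitStep d M) 𝔥 R pΦ) (basisDir d M n) (fun ψ => ∑ x ∈ X, (ν * tau x ψ + u)) φ
      ≤ 2 * ∑ x ∈ X, (2 * |ν| * tau x φ + (|ν| * n * 𝔥 ^ 2 + |u|)) := by linarith
    _ = 4 * |ν| * ∑ x ∈ X, tau x φ + 2 * X.card * (|ν| * n * 𝔥 ^ 2 + |u|) := by
        rw [Finset.sum_add_distrib, Finset.sum_const, nsmul_eq_mul, ← Finset.mul_sum]; ring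

/-- **Stability of `e^{-V(X)}` ([BS-rg-IE] Proposition (prop:Iupperzz) (i) for Slade's `V`, explicit)**:
for `V = gτ² + ντ + u` with `g ≥ 0` and any `q`,
`‖e^{-V(X)}‖_{T_φ(𝔥)} ≤ exp(|X|[gK(q)(n/2)²𝔥⁴ + 2|ν|n𝔥² + 2|u|] + (4|ν| - qg(n/2)𝔥²)Σ_{x∈X}τ_x(φ))`;
choosing `q g (n/2) 𝔥² ≥ 4|ν|` removes the field dependence ("`‖𝓘(b)‖_{T_φ} ≤ e^{O(ε_V(b))(1+‖φ‖²_Φ)}`").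
[cite: BrydgesSlade2015, §5, Proposition (prop:Iupperzz) (i) and its proof ((5.4)–(5.7))] [cite: Slade2017, §6.4.3 ("Stability domains for V … [BS-rg-IE] applies in our present context")] -/
theorem TphiNorm_exp_neg_localPolySum_le {𝔥 R : ℝ} (h𝔥 : 0 < 𝔥) (hR : 0 < R) (pΦ pN : ℕ) {g : ℝ} (hg : 0 ≤ g) (ν u q : ℝ)
    (X : Finset (TorusSite d M)) (φ : TorusSite d M → Fin n → ℝ) :
    TphiNorm pN (latticeFamily (unitStep d M) 𝔥 R pΦ) (basisDir d M n) (fun ψ => Real.exp (-localPolySum g ν u X ψ)) φ ≤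
      Real.exp (X.card * (g * (quarticK q * (2⁻¹ * n) ^ 2 * 𝔥 ^ 4) + 2 * (|ν| * n * 𝔥 ^ 2 + |u|)) +
        (4 * |ν| - q * g * (2⁻¹ * n) * 𝔥 ^ 2) * ∑ x ∈ X, tau x φ) := by
  have hA : ContDiff ℝ ∞ (fun ψ : TorusSite d M → Fin n → ℝ => Real.exp (-(g * ∑ x ∈ X, tau x ψ * tau x ψ))) :=
    Real.contDiff_exp.comp (contDiff_const.mul (ContDiff.sum fun x _ => (contDiff_tau x).mul (contDiff_tau x))).neg
  have hB : ContDiff ℝ ∞ (fun ψ : TorusSite d M → Fin n → ℝ => Real.exp (-(∑ x ∈ X, (ν * tau x ψ + u)))) :=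
    Real.contDiff_exp.comp (ContDiff.sum fun x _ => (contDiff_const.mul (contDiff_tau x)).add contDiff_const).neg
  have e : (fun ψ : TorusSite d M → Fin n → ℝ => Real.exp (-localPolySum g ν u X ψ)) =
      fun ψ => Real.exp (-(g * ∑ x ∈ X, tau x ψ * tau x ψ)) * Real.exp (-(∑ x ∈ X, (ν * tau x ψ + u))) := by
    funext ψ
    rw [← Real.exp_add]
    congr 1
    simp only [localPolySum, localPoly, Finset.mul_sum, neg_add, ← Finset.sum_neg_distrib, ← Finset.sum_add_distrib]
    refine Finset.sum_congr rfl fun x _ => by ring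
  rw [e]
  refine (TphiNorm_mul_le_lattice (unitStep d M) h𝔥 hR pΦ pN (basisDir d M n) hA hB φ).trans ?_
  refine (mul_le_mul (TphiNorm_exp_neg_tau_sq_sum_le h𝔥 hR pΦ pN q hg X φ) (TphiNorm_exp_neg_quadratic_le h𝔥 hR pΦ pN ν u X φ)
    (TphiNorm_nonneg _ _ _ _ _) (by positivity)).trans (le_of_eq ?_)
  rw [← Real.exp_add]
  congr 1
  ring

end LocalPoly

end LongRangePhi4

end Literature.Barriers.CriticalPhenomena
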